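import Mathlib
import HarnessLib
import Summits.HubbardSuperconductivity.HubbardSuperconductivity.Theorems.KLProgrammeC4aCoMovingBridge
import Summits.HubbardSuperconductivity.HubbardSuperconductivity.Theorems.KLProgrammePerturbedFermiCurveTowerOfSizes
import Summits.HubbardSuperconductivity.HubbardSuperconductivity.Theorems.KLProgrammeKLRegimeSplitTwoLegSizesMSChainTable

/-!
# Route `KLProgramme` — crux C4a, (L3) PATH JETS: the angular jets of the pair-sum / pair-difference paths are bounded by TWICE the
# single-curve table `msD A₃ A₄` — uniformly in the base angle `θ`, the loop angle `ϑ` and the level `|ρ| < r`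

Cell `gate-hubbard-kl`, lane hubbard-kl-c4a-1 (g5); helper for stub (C) `stub_twoLeg_curvature` of the engine-flow child `KLRegimeEngineV17F2`
(stmt-HubbardSuperconductivity-20437); memo HOME/hubbard-kl-c4a-1/C4A-PLAN.md §22.3 (i).  The (L3) bridge `coMovingJetsL1_pairSum/_pairDiff`
(`…C4aCoMovingBridge`) takes θ-uniform majorants `Ds i (ρ,ϑ)` of `‖∂ⁱ_t path(t)|_{t=0}‖`.  Since `∂ⁱ_t [Φ(0,θ+t) ± Φ(ρ,ϑ+θ+t)] = γ₀⁽ⁱ⁾(θ) ± γ_ρ⁽ⁱ⁾(ϑ+θ)`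
with `γ_ν` the level-`ν` Fermi curve, and EVERY level curve in the tube obeys the single-frame table `‖γ_ν⁽ⁱ⁾‖ ≤ msD A₃ A₄ i`
(`fermiPointLp_sizes_of_sizes`, keyed by the frame's sizes `A ≤ 1/20`, `A₃`, `A₄` and the TUBE margins `−1.1 < μ − r − A`, `μ + r + A < −0.1`),
the dominators are the constants `Ds i = 2·msD A₃ A₄ i` — `(ρ,ϑ,θ)`-free, hence trivially integrable.

* §1 `pairSumPath_apply_zero`, `iteratedDeriv_pairSumPath_zero` / `iteratedDeriv_pairDiffPath_zero` (jets of the paths = sum / difference of curve jets);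
* §2 `norm_iteratedDeriv_levelPoint_le` (every level curve in the tube: `≤ msD A₃ A₄ i`), **`norm_iteratedDeriv_pairSumPath_le`**,
  **`norm_iteratedDeriv_pairDiffPath_le`** (`≤ 2·msD A₃ A₄ i`, `1 ≤ i ≤ 4`);
* §3 `integrableOn_two_mul_bell4` (Bell dominators are integrable when the `Mb k` are — `bell4` is linear in `Mb`),
  **`coMovingJetsL1_pairSum_of_sizes`** / **`coMovingJetsL1_pairDiff_of_sizes`** — the bridge with the path jets DISCHARGED: only the Fréchet
  majorants `Mb k (ρ,ϑ)` of the bubble along the path and their integrability remain ((L3) proper).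

Proved bookkeeping; nothing about the Hubbard model's sizes; nothing asserts superconductivity.
References: BGM 2006 §2.4 Lemma 2.1 (2.40) [cite: BenfattoGiulianiMastropietro2006]; FST II CPAM 51 (1998) §3.
-/

noncomputable section

namespace Summit.HubbardSuperconductivity.HubbardSuperconductivity.Theorems.C4a

set_option linter.dupNamespace false -- summit = problem name (single-conjunct summit), D-0017

open Real Set MeasureTheory Finset
open scoped ContDiff
open Literature.MathematicalPhysics.QuantumLattice Literature.MathematicalPhysics.QuantumLattice.BandSectorCounting Literature.Probability.LatticeModels
open Summit.HubbardSuperconductivity.HubbardSuperconductivity.Theorems.KLRegimeSplit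
open Summit.HubbardSuperconductivity.HubbardSuperconductivity.Theorems.DispersionFlow
open Summit.HubbardSuperconductivity.HubbardSuperconductivity.Theorems.PerturbedFermiCurve

/-! ## §1 Jets of the paths are sums / differences of curve jets -/

/-- The pair-sum path at `t = 0`. -/
@[simp] theorem pairSumPath_apply_zero (μ : ℝ) (K : TrigPolyC4v) (ρ ϑ θ : ℝ) :
    pairSumPath μ K ρ ϑ θ 0 = levelPoint μ K 0 θ + levelPoint μ K ρ (ϑ + θ) := by
  simp only [pairSumPath, add_zero]

/-- The pair-difference path at `t = 0`. -/
@[simp] theorem pairDiffPath_apply_zero (μ : ℝ) (K : TrigPolyC4v) (ρ ϑ θ : ℝ) :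
    pairDiffPath μ K ρ ϑ θ 0 = levelPoint μ K 0 θ - levelPoint μ K ρ (ϑ + θ) := by
  simp only [pairDiffPath, add_zero]

section Sizes

variable {K : TrigPolyC4v} {A : ℝ} (hA : ∀ p : Momentum, ∀ j ≤ 2, ‖iteratedFDeriv ℝ j (frameShift K) p‖ ≤ A) (hA20 : A ≤ 1 / 20)
  (hd : klCurveD ≤ (bandBounds (show (-4 : ℝ) < -1.1 by norm_num) (show (-1.1 : ℝ) ≤ -0.1 by norm_num)
    (show (-0.1 : ℝ) < 0 by norm_num)).Dtmin - 2 * A)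
  {μ r : ℝ} (hr : 0 < r) (hlo : (-1.1 : ℝ) < μ - r - A) (hhi : μ + r + A < -0.1)
  {A₃ A₄ : ℝ} (hA₃ : ∀ p : Momentum, ‖iteratedFDeriv ℝ 3 (frameShift K) p‖ ≤ A₃)
  (hA₄ : ∀ p : Momentum, ‖iteratedFDeriv ℝ 4 (frameShift K) p‖ ≤ A₄)
include hA hA20 hd hr hlo hhi hA₃ hA₄

omit hA20 hA₃ hA₄ hr in
/-- Every level curve in the tube is `C^∞` in the angle (sizes version of `contDiff_levelPoint_angle`). -/
theorem contDiff_levelPoint_of_sizes {ρ : ℝ} (hρ : |ρ| < r) (i : ℕ) : ContDiff ℝ i (levelPoint μ K ρ) := by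
  have hADt : 2 * A < (bandBounds (show (-4 : ℝ) < -1.1 by norm_num) (show (-1.1 : ℝ) ≤ -0.1 by norm_num)
      (show (-0.1 : ℝ) < 0 by norm_num)).Dtmin := by have := klCurveD_pos; linarith
  exact contDiff_infty.1 (contDiff_levelPoint_angle (bandBounds _ _ _) hA hADt hlo hhi hρ (m := ⊤)) i

omit hA20 hA₃ hA₄ in
/-- **Jets of the pair-sum path**: `∂ⁱ_t S_{ρ,ϑ,θ}(0) = γ₀⁽ⁱ⁾(θ) + γ_ρ⁽ⁱ⁾(ϑ + θ)`. -/
theorem iteratedDeriv_pairSumPath_zero {ρ : ℝ} (hρ : |ρ| < r) (ϑ θ : ℝ) (i : ℕ) :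
    iteratedDeriv i (pairSumPath μ K ρ ϑ θ) 0 = iteratedDeriv i (levelPoint μ K 0) θ + iteratedDeriv i (levelPoint μ K ρ) (ϑ + θ) := by
  have h0 : |(0 : ℝ)| < r := by simpa using hr
  have hc0 : ContDiff ℝ i (fun t : ℝ => levelPoint μ K 0 (θ + t)) :=
    (contDiff_levelPoint_of_sizes hA hd hlo hhi h0 i).comp (contDiff_const.add contDiff_id)
  have hcρ : ContDiff ℝ i (fun t : ℝ => levelPoint μ K ρ (ϑ + θ + t)) :=
    (contDiff_levelPoint_of_sizes hA hd hlo hhi hρ i).comp (contDiff_const.add contDiff_id)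
  have hfun : pairSumPath μ K ρ ϑ θ = fun t => levelPoint μ K 0 (θ + t) + levelPoint μ K ρ (ϑ + θ + t) := rfl
  rw [hfun, iteratedDeriv_fun_add hc0.contDiffAt hcρ.contDiffAt,
    iteratedDeriv_comp_const_add (f := levelPoint μ K 0), iteratedDeriv_comp_const_add (f := levelPoint μ K ρ)]
  simp only [add_zero]

omit hA20 hA₃ hA₄ in
/-- **Jets of the pair-difference path**: `∂ⁱ_t D_{ρ,ϑ,θ}(0) = γ₀⁽ⁱ⁾(θ) − γ_ρ⁽ⁱ⁾(ϑ + θ)`. -/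
theorem iteratedDeriv_pairDiffPath_zero {ρ : ℝ} (hρ : |ρ| < r) (ϑ θ : ℝ) (i : ℕ) :
    iteratedDeriv i (pairDiffPath μ K ρ ϑ θ) 0 = iteratedDeriv i (levelPoint μ K 0) θ - iteratedDeriv i (levelPoint μ K ρ) (ϑ + θ) := by
  have h0 : |(0 : ℝ)| < r := by simpa using hr
  have hc0 : ContDiff ℝ i (fun t : ℝ => levelPoint μ K 0 (θ + t)) :=
    (contDiff_levelPoint_of_sizes hA hd hlo hhi h0 i).comp (contDiff_const.add contDiff_id)
  have hcρ : ContDiff ℝ i (fun t : ℝ => levelPoint μ K ρ (ϑ + θ + t)) :=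
    (contDiff_levelPoint_of_sizes hA hd hlo hhi hρ i).comp (contDiff_const.add contDiff_id)
  have hfun : pairDiffPath μ K ρ ϑ θ = fun t => levelPoint μ K 0 (θ + t) - levelPoint μ K ρ (ϑ + θ + t) := rfl
  rw [hfun, iteratedDeriv_fun_sub hc0.contDiffAt hcρ.contDiffAt,
    iteratedDeriv_comp_const_add (f := levelPoint μ K 0), iteratedDeriv_comp_const_add (f := levelPoint μ K ρ)]
  simp only [add_zero]

/-! ## §2 The single-curve table bounds every level curve in the tube -/

omit hr in
/-- **Every level curve in the tube obeys the single-frame table**: `‖γ_ρ⁽ⁱ⁾(s)‖ ≤ msD A₃ A₄ i` (`1 ≤ i ≤ 4`, `|ρ| < r`).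
[cite: BenfattoGiulianiMastropietro2006, §2.4 Lemma 2.1 (2.40)] -/
theorem norm_iteratedDeriv_levelPoint_le {ρ : ℝ} (hρ : |ρ| < r) {i : ℕ} (hi1 : 1 ≤ i) (hi4 : i ≤ 4) (s : ℝ) :
    ‖iteratedDeriv i (levelPoint μ K ρ) s‖ ≤ msD A₃ A₄ i := by
  have h1 : (-1.1 : ℝ) ≤ μ + ρ - A := by have := (abs_lt.1 hρ).1; linarith
  have h2 : μ + ρ + A ≤ -0.1 := by have := (abs_lt.1 hρ).2; linarith
  have hfun : levelPoint μ K ρ = fun s : ℝ => (WithLp.toLp 2 (klFermiPoint (μ + ρ) K s) : Momentum) := rfl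
  obtain ⟨-, d1, d2, d3, d4⟩ := fermiPointLp_sizes_of_sizes hA hA20 hd h1 h2 hA₃ hA₄ s
  rw [hfun, ← norm_iteratedFDeriv_eq_norm_iteratedDeriv]
  interval_cases i
  · exact d1
  · exact d2
  · exact d3
  · exact d4

/-- **Jets of the pair-sum path**: `‖∂ⁱ_t S_{ρ,ϑ,θ}(0)‖ ≤ 2·msD A₃ A₄ i` (`1 ≤ i ≤ 4`), uniformly in `θ, ϑ` and `|ρ| < r`. -/
theorem norm_iteratedDeriv_pairSumPath_le (θ ρ ϑ : ℝ) (hρ : |ρ| < r) (i : ℕ) (hi1 : 1 ≤ i) (hi4 : i ≤ 4) :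
    ‖iteratedDeriv i (pairSumPath μ K ρ ϑ θ) 0‖ ≤ 2 * msD A₃ A₄ i := by
  have h0 : |(0 : ℝ)| < r := by simpa using hr
  rw [iteratedDeriv_pairSumPath_zero hA hd hr hlo hhi hρ, two_mul]
  exact (norm_add_le _ _).trans (add_le_add (norm_iteratedDeriv_levelPoint_le hA hA20 hd hlo hhi hA₃ hA₄ h0 hi1 hi4 θ)
    (norm_iteratedDeriv_levelPoint_le hA hA20 hd hlo hhi hA₃ hA₄ hρ hi1 hi4 (ϑ + θ)))

/-- **Jets of the pair-difference path**: `‖∂ⁱ_t D_{ρ,ϑ,θ}(0)‖ ≤ 2·msD A₃ A₄ i` (`1 ≤ i ≤ 4`), uniformly in `θ, ϑ` and `|ρ| < r`. -/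
theorem norm_iteratedDeriv_pairDiffPath_le (θ ρ ϑ : ℝ) (hρ : |ρ| < r) (i : ℕ) (hi1 : 1 ≤ i) (hi4 : i ≤ 4) :
    ‖iteratedDeriv i (pairDiffPath μ K ρ ϑ θ) 0‖ ≤ 2 * msD A₃ A₄ i := by
  have h0 : |(0 : ℝ)| < r := by simpa using hr
  rw [iteratedDeriv_pairDiffPath_zero hA hd hr hlo hhi hρ, two_mul]
  exact (norm_sub_le _ _).trans (add_le_add (norm_iteratedDeriv_levelPoint_le hA hA20 hd hlo hhi hA₃ hA₄ h0 hi1 hi4 θ)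
    (norm_iteratedDeriv_levelPoint_le hA hA20 hd hlo hhi hA₃ hA₄ hρ hi1 hi4 (ϑ + θ)))

/-! ## §3 The bridge with the path jets discharged -/

omit hA hA20 hd hr hlo hhi hA₃ hA₄ in
/-- **Bell dominators are integrable when the `Mb k` are**: `bell4 M D j` is linear in `M`, so for constant `D` the dominator
`p ↦ 2·bell4 (Mb · p) D i` is integrable on a set as soon as every `Mb k` (`k ≤ 4`) is. -/
theorem integrableOn_two_mul_bell4 {Mb : ℕ → ℝ × ℝ → ℝ} {D : ℕ → ℝ} {S : Set (ℝ × ℝ)}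
    (hMb : ∀ k ≤ 4, IntegrableOn (Mb k) S) (i : ℕ) (hi : i ≤ 4) :
    IntegrableOn (fun p : ℝ × ℝ => 2 * bell4 (fun k => Mb k p) D i) S := by
  refine Integrable.const_mul ?_ 2
  have h0 := hMb 0 (by norm_num)
  have h1 := hMb 1 (by norm_num)
  have h2 := hMb 2 (by norm_num)
  have h3 := hMb 3 (by norm_num)
  have h4 := hMb 4 le_rfl
  interval_cases i
  · simp only [bell4]
    exact h0
  · simp only [bell4]
    exact h1.mul_const _
  · simp only [bell4]
    exact (h2.mul_const _).add (h1.mul_const _)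
  · simp only [bell4]
    have t2 : IntegrableOn (fun p : ℝ × ℝ => 3 * Mb 2 p * D 1 * D 2) S := ((h2.const_mul 3).mul_const _).mul_const _
    exact ((h3.mul_const _).add t2).add (h1.mul_const _)
  · simp only [bell4]
    have t2 : IntegrableOn (fun p : ℝ × ℝ => 6 * Mb 3 p * D 1 ^ 2 * D 2) S := ((h3.const_mul 6).mul_const _).mul_const _
    have t3 : IntegrableOn (fun p : ℝ × ℝ => 3 * Mb 2 p * D 2 ^ 2) S := (h2.const_mul 3).mul_const _
    have t4 : IntegrableOn (fun p : ℝ × ℝ => 4 * Mb 2 p * D 1 * D 3) S := ((h2.const_mul 4).mul_const _).mul_const _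
    exact ((((h4.mul_const _).add t2).add t3).add t4).add (h1.mul_const _)

/-- **(L3) BRIDGE WITH PATH JETS DISCHARGED, particle–particle class**: for `Bf : Momentum → ℂ` of class `C⁴` with θ-uniform Fréchet
majorants `‖Dᵏ Bf(S_{ρ,ϑ,θ}(0))‖ ≤ Mb k (ρ,ϑ)` (`1 ≤ k ≤ 4`), `‖Bf(S(0))‖ ≤ Mb 0 (ρ,ϑ)`, every `Mb k` integrable on the chart box:
`CoMovingJetsL1 4 (fun i p => 2·bell4 (Mb · p) (2·msD A₃ A₄ ·) i) r μ K (fun k q => Bf (k + q))`. [cite: BenfattoGiulianiMastropietro2006, §2.4 (2.36)–(2.40)] -/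
theorem coMovingJetsL1_pairSum_of_sizes {Bf : Momentum → ℂ} (hB : ContDiff ℝ 4 Bf) {Mb : ℕ → ℝ × ℝ → ℝ}
    (hMb : ∀ θ ρ ϑ : ℝ, |ρ| < r → ∀ k, 1 ≤ k → k ≤ 4 → ‖iteratedFDeriv ℝ k Bf (pairSumPath μ K ρ ϑ θ 0)‖ ≤ Mb k (ρ, ϑ))
    (hMb0 : ∀ θ ρ ϑ : ℝ, |ρ| < r → ‖Bf (pairSumPath μ K ρ ϑ θ 0)‖ ≤ Mb 0 (ρ, ϑ))
    (hint : ∀ k ≤ 4, IntegrableOn (Mb k) (Ioo (-r) r ×ˢ Ioc 0 (2 * π))) :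
    CoMovingJetsL1 4 (fun i p => 2 * bell4 (fun k => Mb k p) (fun i => 2 * msD A₃ A₄ i) i) r μ K (fun k q => Bf (k + q)) := by
  have hADt : 2 * A < (bandBounds (show (-4 : ℝ) < -1.1 by norm_num) (show (-1.1 : ℝ) ≤ -0.1 by norm_num)
      (show (-0.1 : ℝ) < 0 by norm_num)).Dtmin := by have := klCurveD_pos; linarith
  exact coMovingJetsL1_pairSum (bandBounds _ _ _) hA hADt hr hlo hhi hB (Ds := fun i _ => 2 * msD A₃ A₄ i) hMb hMb0
    (fun θ ρ ϑ hρ i hi1 hi4 => norm_iteratedDeriv_pairSumPath_le hA hA20 hd hr hlo hhi hA₃ hA₄ θ ρ ϑ hρ i hi1 hi4)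
    (fun i hi => integrableOn_two_mul_bell4 hint i hi)

/-- **(L3) BRIDGE WITH PATH JETS DISCHARGED, particle–hole exchange class** (`V(k,q) = Bf(k − q)`, path `pairDiffPath`): as
`coMovingJetsL1_pairSum_of_sizes`. [cite: BenfattoGiulianiMastropietro2006, §2.4 (2.36)–(2.40)] -/
theorem coMovingJetsL1_pairDiff_of_sizes {Bf : Momentum → ℂ} (hB : ContDiff ℝ 4 Bf) {Mb : ℕ → ℝ × ℝ → ℝ}
    (hMb : ∀ θ ρ ϑ : ℝ, |ρ| < r → ∀ k, 1 ≤ k → k ≤ 4 → ‖iteratedFDeriv ℝ k Bf (pairDiffPath μ K ρ ϑ θ 0)‖ ≤ Mb k (ρ, ϑ))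
    (hMb0 : ∀ θ ρ ϑ : ℝ, |ρ| < r → ‖Bf (pairDiffPath μ K ρ ϑ θ 0)‖ ≤ Mb 0 (ρ, ϑ))
    (hint : ∀ k ≤ 4, IntegrableOn (Mb k) (Ioo (-r) r ×ˢ Ioc 0 (2 * π))) :
    CoMovingJetsL1 4 (fun i p => 2 * bell4 (fun k => Mb k p) (fun i => 2 * msD A₃ A₄ i) i) r μ K (fun k q => Bf (k - q)) := by
  have hADt : 2 * A < (bandBounds (show (-4 : ℝ) < -1.1 by norm_num) (show (-1.1 : ℝ) ≤ -0.1 by norm_num)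
      (show (-0.1 : ℝ) < 0 by norm_num)).Dtmin := by have := klCurveD_pos; linarith
  exact coMovingJetsL1_pairDiff (bandBounds _ _ _) hA hADt hr hlo hhi hB (Ds := fun i _ => 2 * msD A₃ A₄ i) hMb hMb0
    (fun θ ρ ϑ hρ i hi1 hi4 => norm_iteratedDeriv_pairDiffPath_le hA hA20 hd hr hlo hhi hA₃ hA₄ θ ρ ϑ hρ i hi1 hi4)
    (fun i hi => integrableOn_two_mul_bell4 hint i hi)

end Sizes

end Summit.HubbardSuperconductivity.HubbardSuperconductivity.Theorems.C4a

end
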